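import Literature.NumberTheory.LFunctions.UniformClassGroupPNTGeneralDegreeReduction
import Literature.NumberTheory.LFunctions.UniformClassGroupPNTPsiTheta
import Literature.NumberTheory.LFunctions.GRHPrimeIdealCountLowerBound
import HarnessLib

/-!
# Thorner–Zaman Theorem 1.4 for ideal classes (any degree, and the imaginary quadratic case)
# follows from its `ψ_C`-form (Theorem 5.1 for `H_K/K`, as printed) and Stark's bound

Topic `Literature/NumberTheory/LFunctions` (namespace `Literature.NumberTheory.LFunctions.NumberField`).
Everything here is PROVED (theorems only; no definitions, no named facts).

The proof of [ThornerZaman2019, Thm. 5.1] establishes, for `L/K` abelian and `x ≥ Q^{40 c₅}`,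
`ψ_C(x) = (|C|/|G|) g(x) (1 + O(e^{−(c₄/2) log x/log Q} + e^{−√(c₄ log x/4n_K)}))`,
`g(x) = x − χ₁(C) x^{β₁}/β₁`, and then passes to `π_C` by Lemma 2.1 (partial summation through
`θ_C`, paying `|θ_C − ψ_C| ≪ n_F x^{1/2}` for the prime ideal powers and `O(log D_L + n_F x^{1/2}/log x)`)
and the absorption of `𝓔₀(x)` by (4.8) and Lemma 2.4.  For `L = H_K` (`|C| = 1`, `|G| = h_K`,
`Q = |d_K| n_K^{n_K}`, `|G| ψ_C(x) = Σ_{n ≤ x} Λ_C(n)` with the tree's `classVonMangoldt`) this file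
completes the formalization of that passage for general degree, with absolute constants:

* `exceptionalPsiMain_ge` — `g(t) = t − θ₁ t^β/β ≥ t δ/4` for `θ₁ = ±1`, `δ ≤ 1 − β`, `log t ≥ 4`
  (the `ψ`-analogue of (4.8));
* `psiJunk_le_errorTermN_mul` — absorption of the prime-ideal-power term `2 n_K √t log t`
  (`≥ π_K(√t) log t ≥ |Σ_{n≤t}Λ_C(n) − h_K θ_C(t)|`, `UniformClassGroupPNTPsiTheta.lean`) into
  `6 · errorTermN c Q n t · t Q^{−s}/(4 h)` for `log t ≥ (48 + 8s) log Q`, using `h_K ≤ Q⁴`, `n_K ≤ Q`;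
* `ThornerZaman2019_hilbertClassField_thetaForm_of_psiForm` — the `ψ_C`-form dichotomy (with
  Stark's bound `1 − β₁ ≥ Q^{−s}` in the exceptional case) implies the `θ_C`-form dichotomy
  consumed by `ThornerZaman2019_classPNT_hilbertClassField_of_thetaForm`
  (`UniformClassGroupPNTGeneralDegreeReduction.lean`), with `a' = max(a, 48 + 8s)`,
  `c' = min(c, 1/2)`, `A' = A + 6`;
* `ThornerZaman2019_classPNT_hilbertClassField_of_psiForm` — **the named fact
  `ThornerZaman2019_classPNT_hilbertClassField` follows from the `ψ_C`-form of Thm. 5.1 for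
  `H_K/K` and Stark's bound.**
* `ThornerZaman2019_imaginaryQuadratic_thetaForm_of_psiForm`,
  `ThornerZaman2019_classPNT_imaginaryQuadratic_of_psiForm` — the same passage for the imaginary
  quadratic named fact `ThornerZaman2019_classPNT_imaginaryQuadratic` (`Q = 4|d_K| = condQ K`,
  `E = errorTerm c Q`; feeds the tree's `ThornerZaman2019_classPNT_imaginaryQuadratic_of_thetaForm`):
  the interface between the explicit-formula side (sums of `classVonMangoldt`) and that fact;
* `ThornerZaman2019_classPNT_imaginaryQuadratic_of_hilbertClassField` — consistency: the
  general-degree fact implies the imaginary-quadratic fact of `UniformClassGroupPNT.lean`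
  (`n_K = 2`: `condQn = condQ`, `errorTermN · · 2 = errorTerm`).

What is NOT here (and is all that remains for the named fact): the `ψ_C`-form itself, i.e.
[ThornerZaman2019, Prop. 4.1 + Lemma 2.3] for the class group `L`-functions of an arbitrary
number field with ABSOLUTE constants — the zero-free region (Thm. 3.1), the log-free zero density
estimate with Deuring–Heilbronn repulsion (Thm. 3.2, Weiss), Stark's bound (Thm. 3.3) and the
weighted explicit formula (§4).

## References

* J. Thorner, A. Zaman, *A unified and improved Chebotarev density theorem*, Algebra Number
  Theory 13 (2019) 1039–1068, Lemma 2.1, Lemma 2.3, (4.8), Thm. 5.1 and its proof. [ThornerZaman2019]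
-/

noncomputable section

open scoped NumberField
open Real MeasureTheory Set NumberField

namespace Literature.NumberTheory.LFunctions.NumberField

/-! ### The lower bound for the `ψ`-main term with an exceptional zero -/

/-- **`t − θ₁ t^β/β ≥ t δ/4`** for `log t ≥ 4`, `θ₁ = ±1`, `1/2 < β < 1` and `δ ≤ 1 − β`:
for `θ₁ = −1` trivially; for `θ₁ = 1` from `t^{β−1} = e^{−u}`, `u = (1−β) log t`,
`e^{−u} ≤ 1/(1+u)` and `β(1+u) − 1 = (1−β)(β log t − 1) ≥ (β/4)(1 + u)(1−β)`.  The `ψ`-form of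
[ThornerZaman2019, (4.8)] (`g(x) = x − χ₁(C) x^{β₁}/β₁ ≫ (1−β₁)(log Q) x` there; here with the
absolute range `log t ≥ 4`). [cite: ThornerZaman2019, (4.8)] -/
theorem exceptionalPsiMain_ge {θ₁ β t δ : ℝ} (hθ : θ₁ = 1 ∨ θ₁ = -1) (hβ : 1 / 2 < β) (hβ1 : β < 1)
    (hδ : δ ≤ 1 - β) (ht : 4 ≤ Real.log t) (ht0 : 0 < t) :
    t * δ / 4 ≤ t - θ₁ * t ^ β / β := by
  have hβ0 : 0 < β := by linarith
  have htβ : 0 < t ^ β := Real.rpow_pos_of_pos ht0 β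
  rcases hθ with rfl | rfl
  · -- `θ₁ = 1`
    set L : ℝ := Real.log t with hL
    set u : ℝ := (1 - β) * L with hu
    have hu0 : 0 ≤ u := by rw [hu]; exact mul_nonneg (by linarith) (by linarith)
    have htb : t ^ β = t * Real.exp (-u) := by
      rw [show β = 1 + (β - 1) by ring, Real.rpow_add ht0, Real.rpow_one,
        Real.rpow_def_of_pos ht0]
      congr 1
      rw [hu, hL]; ring_nf
    -- `e^{-u} (1 + u) ≤ 1`
    have hexp : Real.exp (-u) * (1 + u) ≤ 1 := by
      rw [Real.exp_neg, inv_mul_le_iff₀ (Real.exp_pos u), mul_one]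
      linarith [Real.add_one_le_exp u]
    -- `1 ≤ β (1 - δ/4) (1 + u)`
    have hA : (3 + β) / 4 ≤ 1 - δ / 4 := by linarith
    have hB : 1 + 4 * (1 - β) ≤ 1 + u := by rw [hu]; nlinarith
    have hC : 4 ≤ β * (3 + β) * (1 + 4 * (1 - β)) := by
      nlinarith [mul_nonneg (by linarith : (0 : ℝ) ≤ 1 - β)
        (by nlinarith : (0 : ℝ) ≤ 4 * β ^ 2 + 11 * β - 4)]
    have hfinal : 1 ≤ β * (1 - δ / 4) * (1 + u) := by
      calc (1 : ℝ) ≤ β * ((3 + β) / 4) * (1 + 4 * (1 - β)) := by nlinarith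
        _ ≤ β * (1 - δ / 4) * (1 + u) := by
            apply mul_le_mul (mul_le_mul_of_nonneg_left hA hβ0.le) hB (by linarith)
            exact mul_nonneg hβ0.le (by linarith)
    -- hence `e^{-u} ≤ β (1 - δ/4)`
    have hkey : Real.exp (-u) ≤ β * (1 - δ / 4) := by
      have h1u : 0 < 1 + u := by linarith
      have h1 : Real.exp (-u) ≤ 1 / (1 + u) := by
        rw [le_div_iff₀ h1u]; exact hexp
      have h2 : 1 / (1 + u) ≤ β * (1 - δ / 4) := by
        rw [div_le_iff₀ h1u]; linarith
      exact h1.trans h2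
    -- conclude
    rw [one_mul, htb]
    have h3 : t * Real.exp (-u) / β ≤ t * (1 - δ / 4) := by
      rw [div_le_iff₀ hβ0]
      nlinarith [mul_le_mul_of_nonneg_left hkey ht0.le]
    nlinarith
  · -- `θ₁ = −1`
    have hδ1 : δ ≤ 1 := by linarith
    have h1 : t * δ / 4 ≤ t := by nlinarith
    have h2 : 0 ≤ t ^ β / β := div_nonneg htβ.le hβ0.le
    have h3 : t - -1 * t ^ β / β = t + t ^ β / β := by ring
    rw [h3]
    linarith

/-! ### Absorption of the prime-ideal-power term -/

/-- **Absorption of `ψ_C − θ_C`**: for `Q ≥ 12`, `1 ≤ h ≤ Q⁴`, `1 ≤ n ≤ Q`, `s ≥ 0`, `c ≤ 1/2` and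
`log t ≥ (48 + 8s) log Q`: `2 n √t log t ≤ 6 · errorTermN c Q m t · (t Q^{−s}/(4h))` (the
bound `π_K(√t) log t ≤ 2 n_K √t log t` for the prime ideal powers against the lower bound
`g(t)/h ≥ t Q^{−s}/(4h)` for the main term). [cite: ThornerZaman2019, proof of Thm. 5.1] -/
theorem psiJunk_le_errorTermN_mul {Q h n s c t : ℝ} (m : ℕ) (hQ : 12 ≤ Q) (hh1 : 1 ≤ h)
    (hhQ : h ≤ Q ^ (4 : ℕ)) (hn1 : 1 ≤ n) (hnQ : n ≤ Q) (hs : 0 ≤ s) (hc1 : c ≤ 1 / 2)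
    (ht0 : 0 < t) (ht : (48 + 8 * s) * Real.log Q ≤ Real.log t) :
    2 * n * Real.sqrt t * Real.log t ≤
      6 * ThornerZaman.errorTermN c Q m t * (t * Q ^ (-s) / (4 * h)) := by
  have hQ0 : 0 < Q := by linarith
  have hq2 : 2 < Real.log Q := two_lt_log_twelve.trans_le (Real.log_le_log (by norm_num) hQ)
  have hq0 : 0 < Real.log Q := by linarith
  have hsq : 0 ≤ s * Real.log Q := mul_nonneg hs hq0.le
  have hL48 : 48 * Real.log Q ≤ Real.log t := by nlinarith
  have hL0 : 0 < Real.log t := by linarith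
  have hh0 : 0 < h := by linarith
  have hn0 : 0 < n := by linarith
  -- the variables `a = e^{L/8}`, `b = e^{s log Q}`
  set L : ℝ := Real.log t with hL
  set a : ℝ := Real.exp (L / 8) with ha
  set b : ℝ := Real.exp (s * Real.log Q) with hb
  have ha0 : 0 < a := Real.exp_pos _
  have hb0 : 0 < b := Real.exp_pos _
  have hexpL : ∀ k : ℕ, Real.exp (k * (L / 8)) = a ^ k := fun k ↦ by
    rw [ha, ← Real.exp_nat_mul]
  have hsqrt : Real.sqrt t = a ^ 4 := by
    rw [Real.sqrt_eq_rpow, Real.rpow_def_of_pos ht0, ← hexpL 4]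
    congr 1; rw [hL]; push_cast; ring
  have ht8 : t = a ^ 8 := by
    rw [← hexpL 8, show ((8 : ℕ) : ℝ) * (L / 8) = L by push_cast; ring, hL, Real.exp_log ht0]
  have hQs : Q ^ (-s) = b⁻¹ := by
    rw [Real.rpow_def_of_pos hQ0, hb, ← Real.exp_neg]; congr 1; ring
  have hQk : ∀ k : ℕ, Real.exp (k * Real.log Q) = Q ^ k := fun k ↦ by
    rw [Real.exp_nat_mul, Real.exp_log hQ0]
  -- (1) the error term is at least `e^{-L/4} = (a²)⁻¹`
  have hE : (a ^ 2)⁻¹ ≤ ThornerZaman.errorTermN c Q m t := by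
    refine le_trans ?_ (ThornerZaman.exp_le_errorTermN _ _ _ _)
    rw [← hexpL 2, ← Real.exp_neg, Real.exp_le_exp, ← hL, neg_le_neg_iff,
      div_le_iff₀ hq0]
    push_cast
    nlinarith [mul_nonneg (by linarith : (0 : ℝ) ≤ Real.log Q - 4 * c) hL0.le]
  -- (2) the inputs as polynomial inequalities in `a, b, Q`
  have hnh : n * h ≤ Q ^ (5 : ℕ) := by
    rw [show Q ^ (5 : ℕ) = Q * Q ^ (4 : ℕ) by ring]
    exact mul_le_mul hnQ hhQ hh0.le hQ0.le
  have hL8 : L ≤ 8 * a := by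
    have := Real.add_one_le_exp (L / 8); rw [← ha] at this; linarith
  have hk : Q ^ (6 : ℕ) * b * a ≤ a ^ 2 := by
    have h8 : (6 + s) * Real.log Q + L / 8 ≤ 2 * (L / 8) := by rw [hL]; nlinarith
    have := Real.exp_le_exp.mpr h8
    rwa [show (6 + s) * Real.log Q + L / 8 = (6 : ℕ) * Real.log Q + s * Real.log Q + L / 8 by
        push_cast; ring, Real.exp_add, Real.exp_add, hQk 6, ← hb,
      show (2 : ℝ) * (L / 8) = ((2 : ℕ) : ℝ) * (L / 8) by push_cast; ring, hexpL 2,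
      show Real.exp (L / 8) = a from rfl] at this
  -- (3) the core inequality `8 n h L b ≤ 6 a²`
  have core : 8 * (n * h) * L * b ≤ 6 * a ^ 2 := by
    have h1 : 8 * (n * h) * L * b ≤ 64 * Q ^ (5 : ℕ) * a * b := by
      have := mul_le_mul hnh hL8 hL0.le (by positivity)
      nlinarith [mul_le_mul_of_nonneg_right this hb0.le]
    have h2 : 12 * (Q ^ (5 : ℕ) * a * b) ≤ Q ^ (6 : ℕ) * b * a := by
      have : 12 * Q ^ (5 : ℕ) ≤ Q ^ (6 : ℕ) := by
        rw [show Q ^ (6 : ℕ) = Q * Q ^ (5 : ℕ) by ring]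
        exact mul_le_mul_of_nonneg_right hQ (by positivity)
      nlinarith [mul_le_mul_of_nonneg_right this (mul_nonneg ha0.le hb0.le)]
    nlinarith
  -- (4) back to the goal
  have hpos : 0 < 4 * h := by positivity
  have hRHS : 6 * (a ^ 2)⁻¹ * (t * Q ^ (-s) / (4 * h)) ≤
      6 * ThornerZaman.errorTermN c Q m t * (t * Q ^ (-s) / (4 * h)) :=
    mul_le_mul_of_nonneg_right (mul_le_mul_of_nonneg_left hE (by norm_num))
      (div_nonneg (mul_nonneg ht0.le (Real.rpow_nonneg hQ0.le _)) hpos.le)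
  refine le_trans ?_ hRHS
  rw [hsqrt, ht8, hQs]
  rw [show 6 * (a ^ 2)⁻¹ * (a ^ 8 * b⁻¹ / (4 * h)) = (6 * a ^ 2 / (4 * h * b)) * a ^ 4 by
    field_simp]
  rw [show 2 * n * a ^ 4 * L = (2 * n * L) * a ^ 4 by ring]
  refine mul_le_mul_of_nonneg_right ?_ (by positivity)
  rw [le_div_iff₀ (by positivity)]
  nlinarith

/-! ### From the `ψ_C`-form to the `θ_C`-form -/

/-- **The `θ_C`-form of Thorner–Zaman's Theorem 5.1 for `H_K/K` follows from its `ψ_C`-form**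
(general degree).  The `ψ_C`-form is the dichotomy with `Σ_{n ≤ t} Λ_C(n) = h_K ψ_C(t)` in place of
`h_K θ_C(t)`: `|Σ_{n≤t} Λ_C(n) − g_C(t)| ≤ A E(t) g_C(t)` for `t ≥ Q^a` (`g_C(t) = t`, resp.
`t − χ₁(C) t^{β₁}/β₁`, [ThornerZaman2019, Thm. 5.1 proof, display before (5.2)], with Stark's
bound in the exceptional case).  The passage costs the prime-ideal-power term
`|Σ Λ_C − h θ_C| ≤ h π_K(√t) log t ≤ 2 h n_K √t log t` (`abs_sum_classVonMangoldt_sub_card_mul_theta_le`,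
Lemma 2.1), absorbed by `psiJunk_le_errorTermN_mul` and the lower bound `exceptionalPsiMain_ge`;
the constants become `a' = max(a, 48 + 8s)`, `c' = min(c, 1/2)`, `A' = A + 6`, `s' = s`.
[cite: ThornerZaman2019, Lemma 2.1, Thm. 5.1 (proof)] -/
theorem ThornerZaman2019_hilbertClassField_thetaForm_of_psiForm
    (H : ∃ a c A s : ℝ, 0 < a ∧ 0 < c ∧ 0 < A ∧ 0 < s ∧
      ∀ (K : Type) [Field K] [NumberField K], 1 < Module.finrank ℚ K →
        ((∀ χ : ClassGroup (𝓞 K) →* ℂˣ, χ * χ = 1 →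
            ∀ β : ℝ, 1 - 1 / (8 * Real.log (ThornerZaman.condQn K)) < β → β < 1 →
              classGroupLFunction K χ β ≠ 0) ∧
          ∀ (C : ClassGroup (𝓞 K)) (t : ℝ), ThornerZaman.condQn K ^ a ≤ t →
            |∑ n ∈ Finset.Icc 0 ⌊t⌋₊, classVonMangoldt K C n - t| ≤
              A * ThornerZaman.errorTermN c (ThornerZaman.condQn K) (Module.finrank ℚ K) t * t) ∨
        ∃ (χ₁ : ClassGroup (𝓞 K) →* ℂˣ) (β₁ : ℝ), χ₁ * χ₁ = 1 ∧
          1 - 1 / (8 * Real.log (ThornerZaman.condQn K)) < β₁ ∧ β₁ < 1 ∧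
          classGroupLFunction K χ₁ β₁ = 0 ∧
          ThornerZaman.condQn K ^ (-s) ≤ 1 - β₁ ∧
          ∀ (C : ClassGroup (𝓞 K)) (t : ℝ), ThornerZaman.condQn K ^ a ≤ t →
            |∑ n ∈ Finset.Icc 0 ⌊t⌋₊, classVonMangoldt K C n -
                (t - ((χ₁ C : ℂ)).re * t ^ β₁ / β₁)| ≤
              A * ThornerZaman.errorTermN c (ThornerZaman.condQn K) (Module.finrank ℚ K) t *
                (t - ((χ₁ C : ℂ)).re * t ^ β₁ / β₁)) :
    ∃ a c A s : ℝ, 0 < a ∧ 0 < c ∧ 0 < A ∧ 0 < s ∧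
      ∀ (K : Type) [Field K] [NumberField K], 1 < Module.finrank ℚ K →
        ((∀ χ : ClassGroup (𝓞 K) →* ℂˣ, χ * χ = 1 →
            ∀ β : ℝ, 1 - 1 / (8 * Real.log (ThornerZaman.condQn K)) < β → β < 1 →
              classGroupLFunction K χ β ≠ 0) ∧
          ∀ (C : ClassGroup (𝓞 K)) (t : ℝ), ThornerZaman.condQn K ^ a ≤ t →
            |chebyshevThetaIdealClass K C t - t / classNumber K| ≤
              A * ThornerZaman.errorTermN c (ThornerZaman.condQn K) (Module.finrank ℚ K) t *
                (t / classNumber K)) ∨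
        ∃ (χ₁ : ClassGroup (𝓞 K) →* ℂˣ) (β₁ : ℝ), χ₁ * χ₁ = 1 ∧
          1 - 1 / (8 * Real.log (ThornerZaman.condQn K)) < β₁ ∧ β₁ < 1 ∧
          classGroupLFunction K χ₁ β₁ = 0 ∧
          ThornerZaman.condQn K ^ (-s) ≤ 1 - β₁ ∧
          ∀ (C : ClassGroup (𝓞 K)) (t : ℝ), ThornerZaman.condQn K ^ a ≤ t →
            |chebyshevThetaIdealClass K C t -
                (t - ((χ₁ C : ℂ)).re * t ^ β₁ / β₁) / classNumber K| ≤
              A * ThornerZaman.errorTermN c (ThornerZaman.condQn K) (Module.finrank ℚ K) t *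
                ((t - ((χ₁ C : ℂ)).re * t ^ β₁ / β₁) / classNumber K) := by
  obtain ⟨a, c, A, s, ha, hc, hA, hs, hH⟩ := H
  have hc'0 : 0 < min c (1 / 2) := lt_min hc (by norm_num)
  have hc'1 : min c (1 / 2) ≤ 1 / 2 := min_le_right _ _
  have hc'c : min c (1 / 2) ≤ c := min_le_left _ _
  refine ⟨max a (48 + 8 * s), min c (1 / 2), A + 6, s, by positivity, hc'0, by positivity, hs, ?_⟩
  intro K _ _ hK
  set n : ℕ := Module.finrank ℚ K with hn
  -- constants of the field
  have hQ12 : 12 ≤ ThornerZaman.condQn K := ThornerZaman.twelve_le_condQn hK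
  have hQ1 : 1 < ThornerZaman.condQn K := by linarith
  have hQ0 : 0 < ThornerZaman.condQn K := by linarith
  have hq2 : 2 < Real.log (ThornerZaman.condQn K) :=
    two_lt_log_twelve.trans_le (Real.log_le_log (by norm_num) hQ12)
  have hhcard : (classNumber K : ℝ) = Fintype.card (ClassGroup (𝓞 K)) := by rw [classNumber]
  have hh1 : (1 : ℝ) ≤ classNumber K := by exact_mod_cast one_le_classNumber
  have hh0 : (0 : ℝ) < classNumber K := by linarith
  have hhQ : (classNumber K : ℝ) ≤ ThornerZaman.condQn K ^ (4 : ℕ) :=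
    ThornerZaman.classNumber_le_condQn_pow hK
  have hn2 : (2 : ℝ) ≤ n := by exact_mod_cast hK
  have hn1 : (1 : ℝ) ≤ n := by linarith
  have hnQ : (n : ℝ) ≤ ThornerZaman.condQn K := ThornerZaman.finrank_le_condQn
  -- the range `t ≥ Q^{a'}`
  have hrange : ∀ t : ℝ, ThornerZaman.condQn K ^ max a (48 + 8 * s) ≤ t →
      0 < t ∧ 1 ≤ t ∧ 4 ≤ Real.log t ∧ ThornerZaman.condQn K ^ a ≤ t ∧
        (48 + 8 * s) * Real.log (ThornerZaman.condQn K) ≤ Real.log t := by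
    intro t ht
    have htpos : 0 < t := lt_of_lt_of_le (Real.rpow_pos_of_pos hQ0 _) ht
    have ha' : ThornerZaman.condQn K ^ a ≤ t :=
      (Real.rpow_le_rpow_of_exponent_le hQ1.le (le_max_left _ _)).trans ht
    have h48 : ThornerZaman.condQn K ^ (48 + 8 * s) ≤ t :=
      (Real.rpow_le_rpow_of_exponent_le hQ1.le (le_max_right _ _)).trans ht
    have hlog : (48 + 8 * s) * Real.log (ThornerZaman.condQn K) ≤ Real.log t := by
      rw [← Real.log_rpow hQ0]
      exact Real.log_le_log (Real.rpow_pos_of_pos hQ0 _) h48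
    have hsq : 0 ≤ s * Real.log (ThornerZaman.condQn K) := by positivity
    have hL4 : 4 ≤ Real.log t := by nlinarith
    have ht1 : 1 ≤ t := by
      by_contra hlt
      have : Real.log t ≤ 0 := Real.log_nonpos htpos.le (by linarith)
      linarith
    exact ⟨htpos, ht1, hL4, ha', hlog⟩
  -- the prime-ideal-power term: `|Σ Λ_C − h θ_C| ≤ 2 h n √t log t`
  have hbridge : ∀ (C : ClassGroup (𝓞 K)) (t : ℝ), 1 ≤ t →
      |∑ m ∈ Finset.Icc 0 ⌊t⌋₊, classVonMangoldt K C m -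
          (classNumber K : ℝ) * chebyshevThetaIdealClass K C t| ≤
        (classNumber K : ℝ) * (2 * n * Real.sqrt t * Real.log t) := by
    intro C t ht
    rw [hhcard]
    refine (abs_sum_classVonMangoldt_sub_card_mul_theta_le C ht).trans
      (mul_le_mul_of_nonneg_left ?_ (Nat.cast_nonneg _))
    have hπ := primeIdealCount_le_two_mul_finrank_mul K (Real.sqrt_nonneg t)
    rw [← hn] at hπ
    exact mul_le_mul_of_nonneg_right hπ (Real.log_nonneg ht)
  -- monotonicity of the error term in `c`
  have hEc : ∀ t : ℝ, 1 ≤ t → ThornerZaman.errorTermN c (ThornerZaman.condQn K) n t ≤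
      ThornerZaman.errorTermN (min c (1 / 2)) (ThornerZaman.condQn K) n t :=
    fun t ht ↦ ThornerZaman.errorTermN_le_of_le hc'c hQ1 n ht
  -- the common final step: from `|S − g| ≤ A E g`, `g ≥ t Q^{-s}/4`, to the `θ`-form
  have hstep : ∀ (C : ClassGroup (𝓞 K)) (t g : ℝ),
      ThornerZaman.condQn K ^ max a (48 + 8 * s) ≤ t →
      t * ThornerZaman.condQn K ^ (-s) / 4 ≤ g →
      |∑ m ∈ Finset.Icc 0 ⌊t⌋₊, classVonMangoldt K C m - g| ≤
        A * ThornerZaman.errorTermN c (ThornerZaman.condQn K) n t * g →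
      |chebyshevThetaIdealClass K C t - g / classNumber K| ≤
        (A + 6) * ThornerZaman.errorTermN (min c (1 / 2)) (ThornerZaman.condQn K) n t *
          (g / classNumber K) := by
    intro C t g ht hg hψ
    obtain ⟨ht0, ht1, hL4, -, hlog⟩ := hrange t ht
    set E' := ThornerZaman.errorTermN (min c (1 / 2)) (ThornerZaman.condQn K) n t with hE'
    have hE'0 : 0 ≤ E' := (ThornerZaman.errorTermN_pos _ _ _ _).le
    have hg0 : 0 ≤ g := le_trans (by positivity) hg
    -- `|h θ_C − g| ≤ A E g + 2 h n √t log t`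
    have h1 : |(classNumber K : ℝ) * chebyshevThetaIdealClass K C t - g| ≤
        A * E' * g + (classNumber K : ℝ) * (2 * n * Real.sqrt t * Real.log t) := by
      have hb := hbridge C t ht1
      have hAE : A * ThornerZaman.errorTermN c (ThornerZaman.condQn K) n t * g ≤ A * E' * g :=
        mul_le_mul_of_nonneg_right (mul_le_mul_of_nonneg_left (hEc t ht1) hA.le) hg0
      calc |(classNumber K : ℝ) * chebyshevThetaIdealClass K C t - g|
          = |(∑ m ∈ Finset.Icc 0 ⌊t⌋₊, classVonMangoldt K C m - g) -
              (∑ m ∈ Finset.Icc 0 ⌊t⌋₊, classVonMangoldt K C m -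
                (classNumber K : ℝ) * chebyshevThetaIdealClass K C t)| := by ring_nf
        _ ≤ |∑ m ∈ Finset.Icc 0 ⌊t⌋₊, classVonMangoldt K C m - g| +
              |∑ m ∈ Finset.Icc 0 ⌊t⌋₊, classVonMangoldt K C m -
                (classNumber K : ℝ) * chebyshevThetaIdealClass K C t| := abs_sub _ _
        _ ≤ A * E' * g + (classNumber K : ℝ) * (2 * n * Real.sqrt t * Real.log t) :=
            add_le_add (hψ.trans hAE) hb
    -- absorb the junk: `2 n √t log t ≤ 6 E' (t Q^{-s}/(4h)) ≤ 6 E' g/h`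
    have hjunk := psiJunk_le_errorTermN_mul n hQ12 hh1 hhQ hn1 hnQ hs.le hc'1 ht0 hlog
    rw [← hE'] at hjunk
    have hjunk' : 2 * n * Real.sqrt t * Real.log t ≤ 6 * E' * (g / classNumber K) := by
      refine hjunk.trans (mul_le_mul_of_nonneg_left ?_ (by positivity))
      rw [div_le_div_iff₀ (by positivity) hh0]
      nlinarith [mul_le_mul_of_nonneg_right hg hh0.le]
    -- divide by `h`
    have h2 : |chebyshevThetaIdealClass K C t - g / classNumber K| =
        |(classNumber K : ℝ) * chebyshevThetaIdealClass K C t - g| / classNumber K := by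
      rw [← abs_of_pos hh0, ← abs_div, abs_of_pos hh0]
      congr 1
      field_simp
    rw [h2, div_le_iff₀ hh0]
    calc |(classNumber K : ℝ) * chebyshevThetaIdealClass K C t - g|
        ≤ A * E' * g + (classNumber K : ℝ) * (2 * n * Real.sqrt t * Real.log t) := h1
      _ ≤ A * E' * g + (classNumber K : ℝ) * (6 * E' * (g / classNumber K)) := by
          gcongr
      _ = (A + 6) * E' * (g / classNumber K) * classNumber K := by
          field_simp
  -- the dichotomy
  rcases hH K hK with ⟨hzf, hψ⟩ | ⟨χ₁, β₁, hχ₁, hβl, hβu, hL0, hstark, hψ⟩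
  · refine Or.inl ⟨hzf, fun C t ht ↦ ?_⟩
    obtain ⟨ht0, -, -, hta, -⟩ := hrange t ht
    have hg : t * ThornerZaman.condQn K ^ (-s) / 4 ≤ t := by
      have h1 : ThornerZaman.condQn K ^ (-s) ≤ 1 :=
        Real.rpow_le_one_of_one_le_of_nonpos hQ1.le (by linarith)
      nlinarith [mul_le_mul_of_nonneg_left h1 ht0.le]
    exact hstep C t t ht hg (hψ C t hta)
  · refine Or.inr ⟨χ₁, β₁, hχ₁, hβl, hβu, hL0, hstark, fun C t ht ↦ ?_⟩
    obtain ⟨ht0, -, hL4, hta, -⟩ := hrange t ht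
    have hθ1 : ((χ₁ C : ℂ)).re = 1 ∨ ((χ₁ C : ℂ)).re = -1 := re_classGroupChar_apply hχ₁ C
    have hβhalf : 1 / 2 < β₁ := by
      have h16 : 1 / (8 * Real.log (ThornerZaman.condQn K)) ≤ 1 / 16 :=
        one_div_le_one_div_of_le (by norm_num) (by linarith)
      linarith
    have hg := exceptionalPsiMain_ge hθ1 hβhalf hβu hstark hL4 ht0
    exact hstep C t _ ht hg (hψ C t hta)

/-- **Thorner–Zaman's Theorem 1.4 for the ideal classes of a number field of any degree
`n_K > 1`, from its `ψ_C`-form (Theorem 5.1 for `H_K/K`, absolute constants) and Stark's bound**: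
`ThornerZaman2019_hilbertClassField_thetaForm_of_psiForm` followed by
`ThornerZaman2019_classPNT_hilbertClassField_of_thetaForm`.  What remains to be supplied is exactly
the printed `ψ_C(x) = |G|⁻¹ g(x)(1 + O(e^{−c log x/log Q} + e^{−√(c log x)/√n_K}))` for
`x ≥ Q^{a}` ([ThornerZaman2019, proof of Thm. 5.1]: Prop. 4.1 + Lemma 2.3, i.e. the zero-free
region Thm. 3.1, the log-free zero density with Deuring–Heilbronn Thm. 3.2, Stark's bound Thm. 3.3
and the weighted explicit formula §4, all with ABSOLUTE constants).
[cite: ThornerZaman2019, Thm. 1.4 (proof of Thm. 5.1)] -/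
theorem ThornerZaman2019_classPNT_hilbertClassField_of_psiForm
    (H : ∃ a c A s : ℝ, 0 < a ∧ 0 < c ∧ 0 < A ∧ 0 < s ∧
      ∀ (K : Type) [Field K] [NumberField K], 1 < Module.finrank ℚ K →
        ((∀ χ : ClassGroup (𝓞 K) →* ℂˣ, χ * χ = 1 →
            ∀ β : ℝ, 1 - 1 / (8 * Real.log (ThornerZaman.condQn K)) < β → β < 1 →
              classGroupLFunction K χ β ≠ 0) ∧
          ∀ (C : ClassGroup (𝓞 K)) (t : ℝ), ThornerZaman.condQn K ^ a ≤ t →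
            |∑ n ∈ Finset.Icc 0 ⌊t⌋₊, classVonMangoldt K C n - t| ≤
              A * ThornerZaman.errorTermN c (ThornerZaman.condQn K) (Module.finrank ℚ K) t * t) ∨
        ∃ (χ₁ : ClassGroup (𝓞 K) →* ℂˣ) (β₁ : ℝ), χ₁ * χ₁ = 1 ∧
          1 - 1 / (8 * Real.log (ThornerZaman.condQn K)) < β₁ ∧ β₁ < 1 ∧
          classGroupLFunction K χ₁ β₁ = 0 ∧
          ThornerZaman.condQn K ^ (-s) ≤ 1 - β₁ ∧
          ∀ (C : ClassGroup (𝓞 K)) (t : ℝ), ThornerZaman.condQn K ^ a ≤ t →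
            |∑ n ∈ Finset.Icc 0 ⌊t⌋₊, classVonMangoldt K C n -
                (t - ((χ₁ C : ℂ)).re * t ^ β₁ / β₁)| ≤
              A * ThornerZaman.errorTermN c (ThornerZaman.condQn K) (Module.finrank ℚ K) t *
                (t - ((χ₁ C : ℂ)).re * t ^ β₁ / β₁)) :
    ThornerZaman2019_classPNT_hilbertClassField :=
  ThornerZaman2019_classPNT_hilbertClassField_of_thetaForm
    (ThornerZaman2019_hilbertClassField_thetaForm_of_psiForm H)

/-! ### The imaginary quadratic case: `ψ_C`-form ⇒ `θ_C`-form ⇒ the quadratic fact -/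

/-- **The `θ_C`-form of Thorner–Zaman's Theorem 5.1 for `H_K/K`, `K` imaginary quadratic, follows
from its `ψ_C`-form** — the hypothesis of the tree's
`ThornerZaman2019_classPNT_imaginaryQuadratic_of_thetaForm` (`UniformClassGroupPNTReduction.lean`,
`Q = 4|d_K| = condQ K`, `E = errorTerm c Q`) from the same dichotomy with `Σ_{n ≤ t} Λ_C(n)`
(`= h_K ψ_C(t)`) in place of `h_K θ_C(t)` and Stark's bound in the exceptional case; constants
`a' = max(a, 48 + 8s)`, `c' = min(c, 1/2)`, `A' = A + 6`.  Same proof as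
`ThornerZaman2019_hilbertClassField_thetaForm_of_psiForm` with `n_K = 2` (`condQn = condQ`,
`errorTermN · · 2 = errorTerm`). [cite: ThornerZaman2019, Lemma 2.1, Thm. 5.1 (proof)] -/
theorem ThornerZaman2019_imaginaryQuadratic_thetaForm_of_psiForm
    (H : ∃ a c A s : ℝ, 0 < a ∧ 0 < c ∧ 0 < A ∧ 0 < s ∧
      ∀ (K : Type) [Field K] [NumberField K], Module.finrank ℚ K = 2 → IsTotallyComplex K →
        ((∀ χ : ClassGroup (𝓞 K) →* ℂˣ, χ * χ = 1 →
            ∀ β : ℝ, 1 - 1 / (8 * Real.log (ThornerZaman.condQ K)) < β → β < 1 →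
              classGroupLFunction K χ β ≠ 0) ∧
          ∀ (C : ClassGroup (𝓞 K)) (t : ℝ), ThornerZaman.condQ K ^ a ≤ t →
            |∑ n ∈ Finset.Icc 0 ⌊t⌋₊, classVonMangoldt K C n - t| ≤
              A * ThornerZaman.errorTerm c (ThornerZaman.condQ K) t * t) ∨
        ∃ (χ₁ : ClassGroup (𝓞 K) →* ℂˣ) (β₁ : ℝ), χ₁ * χ₁ = 1 ∧
          1 - 1 / (8 * Real.log (ThornerZaman.condQ K)) < β₁ ∧ β₁ < 1 ∧
          classGroupLFunction K χ₁ β₁ = 0 ∧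
          ThornerZaman.condQ K ^ (-s) ≤ 1 - β₁ ∧
          ∀ (C : ClassGroup (𝓞 K)) (t : ℝ), ThornerZaman.condQ K ^ a ≤ t →
            |∑ n ∈ Finset.Icc 0 ⌊t⌋₊, classVonMangoldt K C n -
                (t - ((χ₁ C : ℂ)).re * t ^ β₁ / β₁)| ≤
              A * ThornerZaman.errorTerm c (ThornerZaman.condQ K) t *
                (t - ((χ₁ C : ℂ)).re * t ^ β₁ / β₁)) :
    ∃ a c A s : ℝ, 0 < a ∧ 0 < c ∧ 0 < A ∧ 0 < s ∧
      ∀ (K : Type) [Field K] [NumberField K], Module.finrank ℚ K = 2 → IsTotallyComplex K →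
        ((∀ χ : ClassGroup (𝓞 K) →* ℂˣ, χ * χ = 1 →
            ∀ β : ℝ, 1 - 1 / (8 * Real.log (ThornerZaman.condQ K)) < β → β < 1 →
              classGroupLFunction K χ β ≠ 0) ∧
          ∀ (C : ClassGroup (𝓞 K)) (t : ℝ), ThornerZaman.condQ K ^ a ≤ t →
            |chebyshevThetaIdealClass K C t - t / classNumber K| ≤
              A * ThornerZaman.errorTerm c (ThornerZaman.condQ K) t * (t / classNumber K)) ∨
        ∃ (χ₁ : ClassGroup (𝓞 K) →* ℂˣ) (β₁ : ℝ), χ₁ * χ₁ = 1 ∧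
          1 - 1 / (8 * Real.log (ThornerZaman.condQ K)) < β₁ ∧ β₁ < 1 ∧
          classGroupLFunction K χ₁ β₁ = 0 ∧
          ThornerZaman.condQ K ^ (-s) ≤ 1 - β₁ ∧
          ∀ (C : ClassGroup (𝓞 K)) (t : ℝ), ThornerZaman.condQ K ^ a ≤ t →
            |chebyshevThetaIdealClass K C t -
                (t - ((χ₁ C : ℂ)).re * t ^ β₁ / β₁) / classNumber K| ≤
              A * ThornerZaman.errorTerm c (ThornerZaman.condQ K) t *
                ((t - ((χ₁ C : ℂ)).re * t ^ β₁ / β₁) / classNumber K) := by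
  obtain ⟨a, c, A, s, ha, hc, hA, hs, hH⟩ := H
  have hc'0 : 0 < min c (1 / 2) := lt_min hc (by norm_num)
  have hc'1 : min c (1 / 2) ≤ 1 / 2 := min_le_right _ _
  have hc'c : min c (1 / 2) ≤ c := min_le_left _ _
  refine ⟨max a (48 + 8 * s), min c (1 / 2), A + 6, s, by positivity, hc'0, by positivity, hs, ?_⟩
  intro K _ _ h2 htc
  have hK : 1 < Module.finrank ℚ K := by omega
  have hQeq : ThornerZaman.condQn K = ThornerZaman.condQ K := ThornerZaman.condQn_eq_condQ K h2
  -- constants of the field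
  have hQ12 : 12 ≤ ThornerZaman.condQ K := ThornerZaman.twelve_le_condQ hK
  have hQ1 : 1 < ThornerZaman.condQ K := by linarith
  have hQ0 : 0 < ThornerZaman.condQ K := by linarith
  have hq2 : 2 < Real.log (ThornerZaman.condQ K) :=
    two_lt_log_twelve.trans_le (Real.log_le_log (by norm_num) hQ12)
  have hhcard : (classNumber K : ℝ) = Fintype.card (ClassGroup (𝓞 K)) := by rw [classNumber]
  have hh1 : (1 : ℝ) ≤ classNumber K := by exact_mod_cast one_le_classNumber
  have hh0 : (0 : ℝ) < classNumber K := by linarith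
  have hhQ : (classNumber K : ℝ) ≤ ThornerZaman.condQ K ^ (4 : ℕ) := by
    rw [← hQeq]; exact ThornerZaman.classNumber_le_condQn_pow hK
  have hn1 : (1 : ℝ) ≤ 2 := by norm_num
  have hnQ : (2 : ℝ) ≤ ThornerZaman.condQ K := by linarith
  -- `errorTerm = errorTermN · · 2`
  have hET : ∀ (c' t : ℝ), ThornerZaman.errorTerm c' (ThornerZaman.condQ K) t =
      ThornerZaman.errorTermN c' (ThornerZaman.condQ K) 2 t :=
    fun c' t ↦ (ThornerZaman.errorTermN_two c' _ t).symm
  -- the range `t ≥ Q^{a'}`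
  have hrange : ∀ t : ℝ, ThornerZaman.condQ K ^ max a (48 + 8 * s) ≤ t →
      0 < t ∧ 1 ≤ t ∧ 4 ≤ Real.log t ∧ ThornerZaman.condQ K ^ a ≤ t ∧
        (48 + 8 * s) * Real.log (ThornerZaman.condQ K) ≤ Real.log t := by
    intro t ht
    have htpos : 0 < t := lt_of_lt_of_le (Real.rpow_pos_of_pos hQ0 _) ht
    have ha' : ThornerZaman.condQ K ^ a ≤ t :=
      (Real.rpow_le_rpow_of_exponent_le hQ1.le (le_max_left _ _)).trans ht
    have h48 : ThornerZaman.condQ K ^ (48 + 8 * s) ≤ t :=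
      (Real.rpow_le_rpow_of_exponent_le hQ1.le (le_max_right _ _)).trans ht
    have hlog : (48 + 8 * s) * Real.log (ThornerZaman.condQ K) ≤ Real.log t := by
      rw [← Real.log_rpow hQ0]
      exact Real.log_le_log (Real.rpow_pos_of_pos hQ0 _) h48
    have hsq : 0 ≤ s * Real.log (ThornerZaman.condQ K) := by positivity
    have hL4 : 4 ≤ Real.log t := by nlinarith
    have ht1 : 1 ≤ t := by
      by_contra hlt
      have : Real.log t ≤ 0 := Real.log_nonpos htpos.le (by linarith)
      linarith
    exact ⟨htpos, ht1, hL4, ha', hlog⟩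
  -- the prime-ideal-power term: `|Σ Λ_C − h θ_C| ≤ 4 h √t log t`
  have hbridge : ∀ (C : ClassGroup (𝓞 K)) (t : ℝ), 1 ≤ t →
      |∑ m ∈ Finset.Icc 0 ⌊t⌋₊, classVonMangoldt K C m -
          (classNumber K : ℝ) * chebyshevThetaIdealClass K C t| ≤
        (classNumber K : ℝ) * (2 * 2 * Real.sqrt t * Real.log t) := by
    intro C t ht
    rw [hhcard]
    refine (abs_sum_classVonMangoldt_sub_card_mul_theta_le C ht).trans
      (mul_le_mul_of_nonneg_left ?_ (Nat.cast_nonneg _))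
    have hπ := primeIdealCount_le_two_mul_finrank_mul K (Real.sqrt_nonneg t)
    rw [h2] at hπ
    push_cast at hπ
    exact mul_le_mul_of_nonneg_right hπ (Real.log_nonneg ht)
  -- monotonicity of the error term in `c`
  have hEc : ∀ t : ℝ, 1 ≤ t → ThornerZaman.errorTerm c (ThornerZaman.condQ K) t ≤
      ThornerZaman.errorTerm (min c (1 / 2)) (ThornerZaman.condQ K) t := by
    intro t ht
    rw [hET, hET]
    exact ThornerZaman.errorTermN_le_of_le hc'c hQ1 2 ht
  -- the common final step: from `|S − g| ≤ A E g`, `g ≥ t Q^{-s}/4`, to the `θ`-form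
  have hstep : ∀ (C : ClassGroup (𝓞 K)) (t g : ℝ),
      ThornerZaman.condQ K ^ max a (48 + 8 * s) ≤ t →
      t * ThornerZaman.condQ K ^ (-s) / 4 ≤ g →
      |∑ m ∈ Finset.Icc 0 ⌊t⌋₊, classVonMangoldt K C m - g| ≤
        A * ThornerZaman.errorTerm c (ThornerZaman.condQ K) t * g →
      |chebyshevThetaIdealClass K C t - g / classNumber K| ≤
        (A + 6) * ThornerZaman.errorTerm (min c (1 / 2)) (ThornerZaman.condQ K) t *
          (g / classNumber K) := by
    intro C t g ht hg hψ
    obtain ⟨ht0, ht1, hL4, -, hlog⟩ := hrange t ht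
    set E' := ThornerZaman.errorTerm (min c (1 / 2)) (ThornerZaman.condQ K) t with hE'
    have hE'0 : 0 ≤ E' := (ThornerZaman.errorTerm_pos _ _ _).le
    have hg0 : 0 ≤ g := le_trans (by positivity) hg
    -- `|h θ_C − g| ≤ A E g + 4 h √t log t`
    have h1 : |(classNumber K : ℝ) * chebyshevThetaIdealClass K C t - g| ≤
        A * E' * g + (classNumber K : ℝ) * (2 * 2 * Real.sqrt t * Real.log t) := by
      have hb := hbridge C t ht1
      have hAE : A * ThornerZaman.errorTerm c (ThornerZaman.condQ K) t * g ≤ A * E' * g :=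
        mul_le_mul_of_nonneg_right (mul_le_mul_of_nonneg_left (hEc t ht1) hA.le) hg0
      calc |(classNumber K : ℝ) * chebyshevThetaIdealClass K C t - g|
          = |(∑ m ∈ Finset.Icc 0 ⌊t⌋₊, classVonMangoldt K C m - g) -
              (∑ m ∈ Finset.Icc 0 ⌊t⌋₊, classVonMangoldt K C m -
                (classNumber K : ℝ) * chebyshevThetaIdealClass K C t)| := by ring_nf
        _ ≤ |∑ m ∈ Finset.Icc 0 ⌊t⌋₊, classVonMangoldt K C m - g| +
              |∑ m ∈ Finset.Icc 0 ⌊t⌋₊, classVonMangoldt K C m -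
                (classNumber K : ℝ) * chebyshevThetaIdealClass K C t| := abs_sub _ _
        _ ≤ A * E' * g + (classNumber K : ℝ) * (2 * 2 * Real.sqrt t * Real.log t) :=
            add_le_add (hψ.trans hAE) hb
    -- absorb the junk: `4 √t log t ≤ 6 E' (t Q^{-s}/(4h)) ≤ 6 E' g/h`
    have hjunk := psiJunk_le_errorTermN_mul 2 hQ12 hh1 hhQ hn1 hnQ hs.le hc'1 ht0 hlog
    rw [← hET, ← hE'] at hjunk
    have hjunk' : 2 * 2 * Real.sqrt t * Real.log t ≤ 6 * E' * (g / classNumber K) := by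
      refine hjunk.trans (mul_le_mul_of_nonneg_left ?_ (by positivity))
      rw [div_le_div_iff₀ (by positivity) hh0]
      nlinarith [mul_le_mul_of_nonneg_right hg hh0.le]
    -- divide by `h`
    have h2' : |chebyshevThetaIdealClass K C t - g / classNumber K| =
        |(classNumber K : ℝ) * chebyshevThetaIdealClass K C t - g| / classNumber K := by
      rw [← abs_of_pos hh0, ← abs_div, abs_of_pos hh0]
      congr 1
      field_simp
    rw [h2', div_le_iff₀ hh0]
    calc |(classNumber K : ℝ) * chebyshevThetaIdealClass K C t - g|
        ≤ A * E' * g + (classNumber K : ℝ) * (2 * 2 * Real.sqrt t * Real.log t) := h1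
      _ ≤ A * E' * g + (classNumber K : ℝ) * (6 * E' * (g / classNumber K)) := by
          gcongr
      _ = (A + 6) * E' * (g / classNumber K) * classNumber K := by
          field_simp
  -- the dichotomy
  rcases hH K h2 htc with ⟨hzf, hψ⟩ | ⟨χ₁, β₁, hχ₁, hβl, hβu, hL0, hstark, hψ⟩
  · refine Or.inl ⟨hzf, fun C t ht ↦ ?_⟩
    obtain ⟨ht0, -, -, hta, -⟩ := hrange t ht
    have hg : t * ThornerZaman.condQ K ^ (-s) / 4 ≤ t := by
      have h1 : ThornerZaman.condQ K ^ (-s) ≤ 1 :=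
        Real.rpow_le_one_of_one_le_of_nonpos hQ1.le (by linarith)
      nlinarith [mul_le_mul_of_nonneg_left h1 ht0.le]
    exact hstep C t t ht hg (hψ C t hta)
  · refine Or.inr ⟨χ₁, β₁, hχ₁, hβl, hβu, hL0, hstark, fun C t ht ↦ ?_⟩
    obtain ⟨ht0, -, hL4, hta, -⟩ := hrange t ht
    have hθ1 : ((χ₁ C : ℂ)).re = 1 ∨ ((χ₁ C : ℂ)).re = -1 := re_classGroupChar_apply hχ₁ C
    have hβhalf : 1 / 2 < β₁ := by
      have h16 : 1 / (8 * Real.log (ThornerZaman.condQ K)) ≤ 1 / 16 :=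
        one_div_le_one_div_of_le (by norm_num) (by linarith)
      linarith
    have hg := exceptionalPsiMain_ge hθ1 hβhalf hβu hstark hL4 ht0
    exact hstep C t _ ht hg (hψ C t hta)

/-- **Thorner–Zaman's Theorem 1.4 for the ideal classes of imaginary quadratic fields, from its
`ψ_C`-form (Theorem 5.1 for `H_K/K`) and Stark's bound**: the named fact
`ThornerZaman2019_classPNT_imaginaryQuadratic` of `UniformClassGroupPNT.lean` follows from the
`ψ_C`-form dichotomy (`ThornerZaman2019_imaginaryQuadratic_thetaForm_of_psiForm`, then the tree's
`ThornerZaman2019_classPNT_imaginaryQuadratic_of_thetaForm`).  This is the interface between the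
explicit-formula side of the tree (sums of `classVonMangoldt`, `ClassGroupPsiErrorTerm.lean`) and
the quadratic named fact. [cite: ThornerZaman2019, Thm. 1.4 (proof of Thm. 5.1)] -/
theorem ThornerZaman2019_classPNT_imaginaryQuadratic_of_psiForm
    (H : ∃ a c A s : ℝ, 0 < a ∧ 0 < c ∧ 0 < A ∧ 0 < s ∧
      ∀ (K : Type) [Field K] [NumberField K], Module.finrank ℚ K = 2 → IsTotallyComplex K →
        ((∀ χ : ClassGroup (𝓞 K) →* ℂˣ, χ * χ = 1 →
            ∀ β : ℝ, 1 - 1 / (8 * Real.log (ThornerZaman.condQ K)) < β → β < 1 →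
              classGroupLFunction K χ β ≠ 0) ∧
          ∀ (C : ClassGroup (𝓞 K)) (t : ℝ), ThornerZaman.condQ K ^ a ≤ t →
            |∑ n ∈ Finset.Icc 0 ⌊t⌋₊, classVonMangoldt K C n - t| ≤
              A * ThornerZaman.errorTerm c (ThornerZaman.condQ K) t * t) ∨
        ∃ (χ₁ : ClassGroup (𝓞 K) →* ℂˣ) (β₁ : ℝ), χ₁ * χ₁ = 1 ∧
          1 - 1 / (8 * Real.log (ThornerZaman.condQ K)) < β₁ ∧ β₁ < 1 ∧
          classGroupLFunction K χ₁ β₁ = 0 ∧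
          ThornerZaman.condQ K ^ (-s) ≤ 1 - β₁ ∧
          ∀ (C : ClassGroup (𝓞 K)) (t : ℝ), ThornerZaman.condQ K ^ a ≤ t →
            |∑ n ∈ Finset.Icc 0 ⌊t⌋₊, classVonMangoldt K C n -
                (t - ((χ₁ C : ℂ)).re * t ^ β₁ / β₁)| ≤
              A * ThornerZaman.errorTerm c (ThornerZaman.condQ K) t *
                (t - ((χ₁ C : ℂ)).re * t ^ β₁ / β₁)) :
    ThornerZaman2019_classPNT_imaginaryQuadratic :=
  ThornerZaman2019_classPNT_imaginaryQuadratic_of_thetaForm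
    (ThornerZaman2019_imaginaryQuadratic_thetaForm_of_psiForm H)

/-! ### The general-degree fact contains the imaginary quadratic one -/

/-- **Consistency of the two vendored forms of [ThornerZaman2019, Thm. 1.4]**: the statement for
the Hilbert class field of a number field of any degree `n_K > 1`
(`ThornerZaman2019_classPNT_hilbertClassField`, `Q = |d_K| n_K^{n_K}`) specialises, for `n_K = 2`
(`Q = 4|d_K| = condQ K`, `errorTermN c Q 2 = errorTerm c Q`, the sanity lemmas of
`UniformClassGroupPNTGeneralDegree.lean`), to the statement vendored for imaginary quadratic
fields in `UniformClassGroupPNT.lean` (`ThornerZaman2019_classPNT_imaginaryQuadratic`), with the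
same constants `c₁, c₂, c₃` (the hypothesis `IsTotallyComplex K` is not even needed).
[cite: ThornerZaman2019, Thm. 1.4] -/
theorem ThornerZaman2019_classPNT_imaginaryQuadratic_of_hilbertClassField
    (h : ThornerZaman2019_classPNT_hilbertClassField) :
    ThornerZaman2019_classPNT_imaginaryQuadratic := by
  obtain ⟨c₁, c₂, c₃, hc₁, hc₂, hc₃, hH⟩ := h
  refine ⟨c₁, c₂, c₃, hc₁, hc₂, hc₃, fun K _ _ h2 _ ↦ ?_⟩
  have hK : 1 < Module.finrank ℚ K := by omega
  have hmain := hH K hK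
  simp only [ThornerZaman.condQn_eq_condQ K h2, h2, ThornerZaman.errorTermN_two] at hmain
  exact hmain

end Literature.NumberTheory.LFunctions.NumberField

end
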